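import Summits.HodgeConjecture.CorCM.HypDel.ExtAmbientReceptacleQArchA
import Literature.AlgebraicGeometry.ShimuraVarieties.UnitaryAuxiliarySiegelInjectivity
import Literature.AlgebraicGeometry.ShimuraVarieties.UnitaryAuxiliaryExtLevelQuotient
import Literature.AlgebraicGeometry.ShimuraVarieties.UnitaryAuxiliaryTorusClassNumberProofs
import Literature.AlgebraicGeometry.Motives.ComplexPointsImageStationarity
import Literature.AlgebraicGeometry.Motives.FiniteCoproductVarieties
import Literature.AlgebraicGeometry.ModuliOfAbelianVarieties.SiegelPrincipalLevelFree
import Literature.AlgebraicGeometry.ModuliOfAbelianVarieties.SiegelPrincipalLevelNormal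
import Literature.AlgebraicGeometry.HodgeTheory.RelativeHyperplaneClassHodgeRiemann
import HarnessLib

/-!
# T3 v4.1 `stub_S2inj : S2Inj` — injectivity of the Hodge-type embedding at ONE level of the product tower ([Deligne 1971] Prop. 1.15)

Cell hodgecm-mathlib, fan A, crux `HDel` (item stmt-HodgeConjecture-24835), line `F1ExtHodgeType` v4.1 (B-plan2, workfile
`Cruxes/HDel/Lines/F1ExtHodgeType.lean` 8335372e), stub owner A-p05.  TARGET (by name):
`Summit.HodgeConjecture.CorCM.HypDel.ExtReceptacle.QArch.S2Inj` (★ τ0-v4 `ExtAmbientReceptacleQArchA` :156, TOWER FORM): given the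
complex models `Sc`, `Sg`, a tower of PRODUCT source levels `K̃(N′(m+1)) = K_V(m) × L_V(m)` and morphisms `ι m` into the Siegel levels
`K_δ(N′(m+1))` with the point formula, SOME level `m₀` of the tower is point-injective (`ParamInjective`).

PROOF ([Deligne1971TravauxShimura] Prop. 1.15, «injective à l'infini + noethérien ⇒ injective à un cran fini»), pure ASSEMBLY of tree theorems:
* §1 three bookkeeping lemmas on Siegel classes (level change along `K ≤ K′`; moving a normalising `κ` across
  `[J, aκ] = [J′, a′] ↔ [J, a] = [J′, a′κ⁻¹]`; rewriting the class of a `(U(H)(ℚ) × T₀(ℚ))·(K_V × L_V)`-translate through ★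
  `auxComplexStructure_ratToU21_smul_torus`, ★ `gspRationalToFinAdelic_auxToGspRat`, ★ `SiegelShimuraSet.mk_conjAct_smul`);
* §2 along the factorial sub-tower `m_k = (k+1)! − 1` (levels `N′(k+1)!`), with `T = Sh_{K_V(0) × L_V(0)}`, `π_k =` ★ `Aux.extLevelMap` and
  `f_k = ι m_k`, the IMAGE relations `R_k = {(π_k P, π_k Q) | f_k P = f_k Q} ⊆ T(ℂ)²` are antitone (Siegel level change) and
  `⋂_k R_k` lies in the diagonal by the MODEL-FREE CORE ★ `Aux.shimuraSet_mk_eq_and_classOf_eq_of_forall_siegel_mk_eq` (finite rational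
  transporter + compact · shrinking levels + rational points of `ũ` + `J_x` determines `x`); the Noetherian IMAGE-stationarity ★
  `Motives.exists_setOf_exists_map_eq_subset_of_iInter_subset` (sources projective: ★ `isProjectiveOver_of_isColimit_cofan`, ★
  `finite_classGroup_printed_holds`; targets separated: ★ `IsQuasiProjectiveOver.isSeparated`) gives ONE `k₀` with `R_{k₀} ⊆ Δ`;
* §3 at `m₀ = m_{k₀}`: equal Siegel images ⇒ equal images in `T` ⇒ the two source points differ by `u ∈ K_V(0) × L_V(0)` ⇒ (§1) `[J_x, ũ(a,t)·ũ(u)]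
  = [J_x, ũ(a,t)]` at level `N′(k₀+1)! ≥ 3` ⇒ ★ Q3 `mem_principalLevelSubgroup_of_mk_mul_eq_mk` `ũ(u) ∈ K_δ(N′(k₀+1)!)` ⇒ `u ∈ K_V(m₀) × L_V(m₀)`
  (`IsProductLevel`) ⇒ `ParamInjective` at `m₀`.
No new facts; 0 sorry.  HC_CM is proved only modulo the 7 printed citations until rung 0 closes; this file discharges the registered
stub `stub_S2inj` of the HDel line only (`--supports stmt-HodgeConjecture-24835`).
[cite: Deligne1971TravauxShimura, Prop. 1.15 p. 132, 5.4] [cite: Deligne1979ShimuraVarieties, Prop. 2.3.10, 2.1.2] [cite: Milne2005ShimuraVarieties, Lemma 5.13 p. 57, Thm. 5.17]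
-/

set_option autoImplicit false
set_option linter.dupNamespace false

noncomputable section

open Function MulAction Topology NumberField IsDedekindDomain CategoryTheory CategoryTheory.Limits Matrix AlgebraicGeometry
open scoped Matrix ComplexOrder
open Literature.AlgebraicGeometry Literature.AlgebraicGeometry.Motives
open Literature.NumberTheory.Automorphic Literature.NumberTheory.Automorphic.UnitaryGroup
open Literature.NumberTheory.Automorphic.Liu2021.AppendixC (C5.OpenCompactSubgroup C5.SmallLevel)
open Literature.Geometry.ComplexHyperbolic Literature.Geometry.ComplexHyperbolic.BallModel
open Literature.AlgebraicGeometry.ShimuraVarieties Literature.AlgebraicGeometry.ShimuraVarieties.UnitaryCanonicalModel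
open Literature.AlgebraicGeometry.ShimuraVarieties.UnitaryCanonicalModel.Aux
open Literature.AlgebraicGeometry.ModuliOfAbelianVarieties
open Summit.HodgeConjecture.CorCM.HypDel.ExtReceptacle.QArch
open Summit.HodgeConjecture.CorCM.HypDel.ExtReceptacle (QArch.S2Inj)

namespace Summit.HodgeConjecture.HodgeConjecture.Theorems

/-! ### §1. Bookkeeping on Siegel classes -/

section Siegel

variable {g : ℕ} {δ : Fin g → ℕ}

/-- **Level change**: `[J, aK] = [J′, a′K] ⇒ [J, aK′] = [J′, a′K′]` for `K ≤ K′` (the same rational transporter works).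
[cite: Milne2005ShimuraVarieties, §5 (5.1) p. 56 and Lemma 5.13 p. 57] -/
theorem siegelShimuraSet_mk_eq_mk_of_le {K K' : Subgroup (gspFinAdelic δ)} (hKK' : K ≤ K') {J J' : C0pm δ}
    {a a' : gspFinAdelic δ} (h : SiegelShimuraSet.mk δ K J a = SiegelShimuraSet.mk δ K J' a') :
    SiegelShimuraSet.mk δ K' J a = SiegelShimuraSet.mk δ K' J' a' := by
  obtain ⟨γ, hJ, hq⟩ := (SiegelShimuraSet.mk_eq_mk_iff δ K J J' a a').1 h
  rw [MulAction.Quotient.smul_mk, QuotientGroup.eq] at hq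
  refine (SiegelShimuraSet.mk_eq_mk_iff δ K' J J' a a').2 ⟨γ, hJ, ?_⟩
  rw [MulAction.Quotient.smul_mk, QuotientGroup.eq]
  exact hKK' hq

/-- **Moving a normalising element across**: for `κ ∈ K_δ(1)` (which normalises every `K_δ(N)`, ★ `principalLevelSubgroup_normal_in_one`),
`[J, aκ] = [J′, a′]` at level `K_δ(N)` iff `[J, a] = [J′, a′κ⁻¹]`. [cite: Milne2005ShimuraVarieties, §5 (5.1) p. 56, §6 p. 70] -/
theorem siegelShimuraSet_mk_mul_eq_mk_iff (N : ℕ) {κ : gspFinAdelic δ} (hκ : κ ∈ principalLevelSubgroup δ 1) (J J' : C0pm δ)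
    (a a' : gspFinAdelic δ) :
    SiegelShimuraSet.mk δ (principalLevelSubgroup δ N) J (a * κ) = SiegelShimuraSet.mk δ (principalLevelSubgroup δ N) J' a' ↔
      SiegelShimuraSet.mk δ (principalLevelSubgroup δ N) J a = SiegelShimuraSet.mk δ (principalLevelSubgroup δ N) J' (a' * κ⁻¹) := by
  rw [SiegelShimuraSet.mk_eq_mk_iff, SiegelShimuraSet.mk_eq_mk_iff]
  refine exists_congr fun γ => and_congr_right fun _ => ?_
  rw [MulAction.Quotient.smul_mk, smul_eq_mul, QuotientGroup.eq, MulAction.Quotient.smul_mk, smul_eq_mul, QuotientGroup.eq]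
  -- `X κ ∈ K ↔ κ X ∈ K` for `X = (γa′)⁻¹ a`, by normality under `κ ∈ K_δ(1)`
  set X : gspFinAdelic δ := (gspRationalToFinAdelic δ γ * a')⁻¹ * a with hX
  have h1 : (gspRationalToFinAdelic δ γ * a')⁻¹ * (a * κ) = X * κ := by rw [hX]; group
  have h2 : (gspRationalToFinAdelic δ γ * (a' * κ⁻¹))⁻¹ * a = κ * X := by rw [hX]; group
  rw [h1, h2]
  constructor
  · intro h
    have := principalLevelSubgroup_normal_in_one δ N hκ h
    have heq : κ * (X * κ) * κ⁻¹ = κ * X := by group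
    rwa [heq] at this
  · intro h
    have := principalLevelSubgroup_normal_in_one δ N (inv_mem hκ) h
    have heq : κ⁻¹ * (κ * X) * κ⁻¹⁻¹ = X * κ := by group
    rwa [heq] at this

end Siegel

section Translate

variable {L : Type} [Field L] [NumberField L] [IsCMField L] {M : Type} [Field M] [NumberField M] [IsCMField M]
  {j : L →+* M} {H : Matrix (Fin 3) (Fin 3) L} {ξ₀ ξ : M} {g : ℕ} {δ : Fin g → ℕ}
  (F : SymplecticFrame M j H ξ₀ ξ g δ) (τ : L →+* ℂ) (Φ : CMType M) (T : GL (Fin 3) ℂ)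
  (hT : formCongr (starRingEnd ℂ) T (H.map τ) = BallModel.J)

/-- **The Siegel class of a `(U(H)(ℚ) × T₀(ℚ))·(K_V × L_V)`-translate.**  If `ρ(γ)·x′ = x` (`γ ∈ U(H)(ℚ)`) and `t⁻¹t′ = r·l` with `r`
the image of `r₀ ∈ T₀(M)(ℚ)`, then at any level `K`:
`[J_{x′}, ũ(a′,t′)]_K = [J_x, ũ(a,t)·ũ(a⁻¹γa′, l)]_K` — by equivariance ★ `auxComplexStructure_ratToU21_smul_torus`, the square ★
`gspRationalToFinAdelic_auxToGspRat` and `GSp_δ(ℚ)`-invariance of the class ★ `SiegelShimuraSet.mk_conjAct_smul`.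
[cite: Deligne1979ShimuraVarieties, Prop. 2.3.10, 2.1.2 (PDF pp. 32, 24)] [cite: Milne2005ShimuraVarieties, Lemma 5.13 p. 57] -/
theorem siegelShimuraSet_mk_eq_mk_mul_of_rel (hJ : ∀ x : Ball, auxComplexStructure F τ Φ T x ∈ C0pm δ)
    (K : Subgroup (gspFinAdelic δ)) {x x' : Ball}
    {a a' : finAdelic (↥(maximalRealSubfield L)) L (IsCMField.complexConj L) 3 H} {t t' : ↥(torusFinAdelic M)}
    (γ : rational (↥(maximalRealSubfield L)) L (IsCMField.complexConj L) 3 H) (hx : ratToU21 L H τ T hT γ • x' = x)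
    (r₀ : torusRat M) {l : ↥(torusFinAdelic M)} (ht : t⁻¹ * t' = toTorusFinAdelic M r₀ * l) :
    SiegelShimuraSet.mk δ K ⟨auxComplexStructure F τ Φ T x', hJ x'⟩ (auxToGspFin F (a', t')) =
      SiegelShimuraSet.mk δ K ⟨auxComplexStructure F τ Φ T x, hJ x⟩
        (auxToGspFin F (a, t) *
          auxToGspFin F (a⁻¹ * (rationalToFinAdelic (↥(maximalRealSubfield L)) L (IsCMField.complexConj L) 3 H γ * a'), l)) := by
  set gq : gspRational δ := auxToGspRat F (γ⁻¹, r₀) with hgq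
  -- the adelic identity `ũ(a′,t′) = (gq)_𝔸 · ũ(a,t) · ũ(a⁻¹γa′, l)`
  have hx' : x' = ratToU21 L H τ T hT γ⁻¹ • x := by
    rw [← hx, map_inv, inv_smul_smul]
  have ht' : t' = toTorusFinAdelic M r₀ * t * l := by
    have := mul_eq_of_eq_inv_mul (a := t) ht.symm  -- t * (r*l) = t'  ↔ r*l = t⁻¹ t'
    rw [← this, ← mul_assoc, mul_comm t (toTorusFinAdelic M r₀)]
  have hpair : ((a', t') : ↥(finAdelic (↥(maximalRealSubfield L)) L (IsCMField.complexConj L) 3 H) × ↥(torusFinAdelic M)) =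
      (rationalToFinAdelic (↥(maximalRealSubfield L)) L (IsCMField.complexConj L) 3 H γ⁻¹, toTorusFinAdelic M r₀) *
        ((a, t) * (a⁻¹ * (rationalToFinAdelic (↥(maximalRealSubfield L)) L (IsCMField.complexConj L) 3 H γ * a'), l)) := by
    refine Prod.ext ?_ ?_
    · simp only [Prod.fst_mul, map_inv]
      group
    · simp only [Prod.snd_mul]
      rw [ht', mul_assoc]
  have hadel : auxToGspFin F (a', t') = gspRationalToFinAdelic δ gq *
      (auxToGspFin F (a, t) *
        auxToGspFin F (a⁻¹ * (rationalToFinAdelic (↥(maximalRealSubfield L)) L (IsCMField.complexConj L) 3 H γ * a'), l)) := by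
    rw [hpair, map_mul, map_mul, hgq, gspRationalToFinAdelic_auxToGspRat]
  -- the point: `J_{x′} = gq_ℝ · J_x`
  have hpt : (⟨auxComplexStructure F τ Φ T x', hJ x'⟩ : C0pm δ) =
      conjAct δ (gspRationalToReal δ gq) ⟨auxComplexStructure F τ Φ T x, hJ x⟩ := by
    apply Subtype.ext
    rw [coe_conjAct, hx', hgq]
    exact auxComplexStructure_ratToU21_smul_torus F τ Φ T hT γ⁻¹ r₀ x
  rw [hpt, hadel, SiegelShimuraSet.mk_conjAct_smul]

end Translate

/-! ### §2–§3. The stub -/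

set_option maxHeartbeats 1600000 in
/-- **`stub_S2inj` of the HDel line F1ExtHodgeType v4.1 — `S2Inj` (tower form) holds** (verbatim registered header; alias `stub_S2inj_holds` below).  [Deligne 1971] Prop. 1.15 for the
Hodge-type embedding `(U(H) × T₀(M), 𝔹² × {h_Φ}) ↪ (GSp_δ, S^±)` at product levels: injectivity at infinite level (★ model-free core) +
Noetherian image-stationarity along the factorial sub-tower (★ `exists_setOf_exists_map_eq_subset_of_iInter_subset`) + freeness of
`K_δ(N′)/K_δ(N′(k₀+1)!)` (★ Q3) ⇒ `ParamInjective` at `m₀ = (k₀+1)! − 1`.  HC_CM is proved only modulo the 7 printed citations until rung 0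
closes. [cite: Deligne1971TravauxShimura, Prop. 1.15 p. 132 and 5.4] [cite: Milne2005ShimuraVarieties, Lemma 5.13, Thm. 5.17] -/
theorem stub_S2inj : QArch.S2Inj := by
  intro L _ _ _ H τ T hT hpos hanis K₀ hneat Sc M _ _ _ j Φ hΦ ξ₀ ξ g δ F haux hg hpol hJ Sg N' hN' KV LV hprod ι hPF
  classical
  -- the factorial sub-tower `m_k = (k+1)! - 1`, levels `N′(k+1)!`
  set mk : ℕ → ℕ := fun k => (k + 1).factorial - 1 with hmkdef
  have hmk : ∀ k, mk k + 1 = (k + 1).factorial := fun k => Nat.sub_add_cancel (Nat.succ_le_of_lt (Nat.factorial_pos _))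
  have hn : ∀ k, N' * (mk k + 1) = N' * (k + 1).factorial := fun k => by rw [hmk]
  have hmk0 : mk 0 = 0 := rfl
  have hN'0 : N' ≠ 0 := by omega
  -- levels of the tower lie below level `0`
  have hle : ∀ m, (KV m).1.1 ≤ (KV 0).1.1 ∧ (LV m).1 ≤ (LV 0).1 := by
    intro m
    have hsub : auxLevel F (N' * (m + 1)) ≤ auxLevel F (N' * (0 + 1)) :=
      auxLevel_anti F (mul_dvd_mul_left N' (one_dvd _))
    rw [show auxLevel F (N' * (m + 1)) = (KV m).1.1.prod (LV m).1 from hprod m,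
      show auxLevel F (N' * (0 + 1)) = (KV 0).1.1.prod (LV 0).1 from hprod 0] at hsub
    refine ⟨fun y hy => ?_, fun z hz => ?_⟩
    · have := hsub (Subgroup.mem_prod.2 ⟨hy, one_mem _⟩ : (y, (1 : ↥(torusFinAdelic M))) ∈ (KV m).1.1.prod (LV m).1)
      exact (Subgroup.mem_prod.1 this).1
    · have := hsub (Subgroup.mem_prod.2 ⟨one_mem _, hz⟩ :
        ((1 : ↥(finAdelic (↥(maximalRealSubfield L)) L (IsCMField.complexConj L) 3 H)), z) ∈ (KV m).1.1.prod (LV m).1)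
      exact (Subgroup.mem_prod.1 this).2
  have hKle : ∀ m, KV m ≤ KV 0 := fun m => (hle m).1
  have hLle : ∀ m, LV m ≤ LV 0 := fun m => (hle m).2
  have hprod0 : auxLevel F N' = (KV 0).1.1.prod (LV 0).1 := by
    have := hprod 0
    rwa [IsProductLevel, Nat.zero_add, Nat.mul_one] at this
  -- the tower of the Noetherian argument
  set Tm := (complexSystemExt M Sc (LV 0)).obj (KV 0) with hTm
  set S : ℕ → SchemeOver ℂ := fun k => (complexSystemExt M Sc (LV (mk k))).obj (KV (mk k)) with hS
  set π : ∀ k, S k ⟶ Tm := fun k => extLevelMap M Sc (hLle (mk k)) (homOfLE (hKle (mk k))) with hπ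
  set A : ℕ → SchemeOver ℂ := fun k => Sg.Mc.obj (SiegelLevel.ofNat δ (N' * (mk k + 1)) (three_le_mul_succ hN' (mk k))) with hA
  set f : ∀ k, S k ⟶ A k := fun k => ι (mk k) with hf
  haveI hfin : ∀ m, Finite (classGroup M (LV m)) := fun m => finite_classGroup_printed_holds M (LV m)
  have hproj : ∀ m, IsProjectiveOver ((complexSystemExt M Sc (LV m)).obj (KV m)) := fun m =>
    isProjectiveOver_of_isColimit_cofan (coproductIsCoproduct fun _ : classGroup M (LV m) => Sc.Mc.obj (KV m))
      fun _ => Sc.projective (KV m)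
  haveI hsep : ∀ k, IsSeparated (A k).hom := fun k => (Sg.quasiProjective _).isSeparated
  -- point formulas for `π_k` and `f_k`, surjectivity of the summand-point presentation
  have hπpt : ∀ k (t : ↥(torusFinAdelic M)) (x : Ball) (a : finAdelic (↥(maximalRealSubfield L)) L (IsCMField.complexConj L) 3 H),
      AlgPoints.map (π k) (summandPointExt M Sc (LV (mk k)) (KV (mk k)) (classOf M (LV (mk k)) t) x a) =
        summandPointExt M Sc (LV 0) (KV 0) (classOf M (LV 0) t) x a := fun k t x a =>
    extLevelMap_summandPointExt M Sc (hLle (mk k)) (homOfLE (hKle (mk k))) _ x a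
  have hfpt : ∀ k (t : ↥(torusFinAdelic M)) (x : Ball) (a : finAdelic (↥(maximalRealSubfield L)) L (IsCMField.complexConj L) 3 H),
      AlgPoints.map (f k) (summandPointExt M Sc (LV (mk k)) (KV (mk k)) (classOf M (LV (mk k)) t) x a) =
        (Sg.pts (SiegelLevel.ofNat δ (N' * (mk k + 1)) (three_le_mul_succ hN' (mk k)))).symm
          (SiegelShimuraSet.mk δ (principalLevelSubgroup δ (N' * (mk k + 1))) ⟨auxComplexStructure F τ Φ T x, hJ x⟩
            (auxToGspFin F (a, t))) := fun k t x a =>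
    hPF (mk k) (classOf M (LV (mk k)) t) x a t rfl
  have hfeq : ∀ k (t t' : ↥(torusFinAdelic M)) (x x' : Ball)
      (a a' : finAdelic (↥(maximalRealSubfield L)) L (IsCMField.complexConj L) 3 H),
      AlgPoints.map (f k) (summandPointExt M Sc (LV (mk k)) (KV (mk k)) (classOf M (LV (mk k)) t) x a) =
          AlgPoints.map (f k) (summandPointExt M Sc (LV (mk k)) (KV (mk k)) (classOf M (LV (mk k)) t') x' a') ↔
        SiegelShimuraSet.mk δ (principalLevelSubgroup δ (N' * (mk k + 1))) ⟨auxComplexStructure F τ Φ T x, hJ x⟩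
            (auxToGspFin F (a, t)) =
          SiegelShimuraSet.mk δ (principalLevelSubgroup δ (N' * (mk k + 1))) ⟨auxComplexStructure F τ Φ T x', hJ x'⟩
            (auxToGspFin F (a', t')) := fun k t t' x x' a a' => by
    rw [hfpt, hfpt]
    exact (Sg.pts _).symm.injective.eq_iff
  have hsurj : ∀ (m : ℕ) (P : ComplexPoints ((complexSystemExt M Sc (LV m)).obj (KV m))),
      ∃ (t : ↥(torusFinAdelic M)) (x : Ball) (a : finAdelic (↥(maximalRealSubfield L)) L (IsCMField.complexConj L) 3 H),
        summandPointExt M Sc (LV m) (KV m) (classOf M (LV m) t) x a = P := by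
    intro m P
    obtain ⟨p, x, a, rfl⟩ := exists_summandPointExt_eq M Sc (LV m) (KV m) P
    obtain ⟨t, rfl⟩ := QuotientGroup.mk'_surjective _ p
    exact ⟨t, x, a, rfl⟩
  -- unpacking an equality in `T(ℂ)`: same unitary class at `K_V(0)` and same torus class at `L_V(0)`, with explicit witnesses
  have hunpack : ∀ {t t' : ↥(torusFinAdelic M)} {x x' : Ball}
      {a a' : finAdelic (↥(maximalRealSubfield L)) L (IsCMField.complexConj L) 3 H},
      summandPointExt M Sc (LV 0) (KV 0) (classOf M (LV 0) t) x a = summandPointExt M Sc (LV 0) (KV 0) (classOf M (LV 0) t') x' a' →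
        ∃ (γ : rational (↥(maximalRealSubfield L)) L (IsCMField.complexConj L) 3 H) (r₀ : torusRat M) (l : ↥(torusFinAdelic M)),
          ratToU21 L H τ T hT γ • x' = x ∧
            (a⁻¹ * (rationalToFinAdelic (↥(maximalRealSubfield L)) L (IsCMField.complexConj L) 3 H γ * a') : _) ∈ (KV 0).1.1 ∧
            l ∈ (LV 0).1 ∧ t⁻¹ * t' = toTorusFinAdelic M r₀ * l := by
    intro t t' x x' a a' h
    obtain ⟨hcl, hmk'⟩ := (summandPointExt_eq_summandPointExt_iff M Sc (LV 0) (KV 0) _ _ x x' a a').1 h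
    obtain ⟨γ, hγx, hγa⟩ := (ShimuraSet.mk_eq_mk_iff L H τ T hT (KV 0).1.1 x x' a a').1 hmk'
    have hcl' : t⁻¹ * t' ∈ (toTorusFinAdelic M).range ⊔ (LV 0).1 := by
      rw [← QuotientGroup.eq]; exact hcl
    obtain ⟨r, hr, l, hl, hrl⟩ := Subgroup.mem_sup.1 hcl'
    obtain ⟨r₀, rfl⟩ := hr
    exact ⟨γ, r₀, l, hγx, hγa, hl, hrl.symm⟩
  -- §2a the image relations are antitone
  have hanti : Antitone fun k => {PQ : ComplexPoints Tm × ComplexPoints Tm | ∃ P Q : ComplexPoints (S k),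
      AlgPoints.map (π k) P = PQ.1 ∧ AlgPoints.map (π k) Q = PQ.2 ∧ AlgPoints.map (f k) P = AlgPoints.map (f k) Q} := by
    intro k k' hkk' PQ hPQ
    obtain ⟨P', Q', hP', hQ', hf'⟩ := hPQ
    obtain ⟨s, y, b, rfl⟩ := hsurj (mk k') P'
    obtain ⟨s', y', b', rfl⟩ := hsurj (mk k') Q'
    rw [hfeq] at hf'
    have hdvd : N' * (mk k + 1) ∣ N' * (mk k' + 1) := by
      rw [hn, hn]; exact mul_dvd_mul_left N' (Nat.factorial_dvd_factorial (Nat.succ_le_succ hkk'))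
    have hf : SiegelShimuraSet.mk δ (principalLevelSubgroup δ (N' * (mk k + 1))) ⟨auxComplexStructure F τ Φ T y, hJ y⟩
          (auxToGspFin F (b, s)) =
        SiegelShimuraSet.mk δ (principalLevelSubgroup δ (N' * (mk k + 1))) ⟨auxComplexStructure F τ Φ T y', hJ y'⟩
          (auxToGspFin F (b', s')) :=
      siegelShimuraSet_mk_eq_mk_of_le (principalLevelSubgroup_anti δ hdvd) hf'
    refine ⟨summandPointExt M Sc (LV (mk k)) (KV (mk k)) (classOf M (LV (mk k)) s) y b,
      summandPointExt M Sc (LV (mk k)) (KV (mk k)) (classOf M (LV (mk k)) s') y' b', ?_, ?_, (hfeq k _ _ _ _ _ _).2 hf⟩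
    · rw [← hP', hπpt, hπpt]
    · rw [← hQ', hπpt, hπpt]
  -- §2b injectivity at infinite level: `⋂_k R_k ⊆ Δ` (the model-free core)
  have hinter : (⋂ k, {PQ : ComplexPoints Tm × ComplexPoints Tm | ∃ P Q : ComplexPoints (S k),
      AlgPoints.map (π k) P = PQ.1 ∧ AlgPoints.map (π k) Q = PQ.2 ∧ AlgPoints.map (f k) P = AlgPoints.map (f k) Q}) ⊆
      {PQ | PQ.1 = PQ.2} := by
    intro PQ hPQ
    rw [Set.mem_iInter] at hPQ
    obtain ⟨t, x, a, h1⟩ := hsurj 0 PQ.1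
    obtain ⟨t', x', a', h2⟩ := hsurj 0 PQ.2
    show PQ.1 = PQ.2
    rw [← h1, ← h2]
    -- the hypothesis of the core, level by level
    have hcore : ∀ k : ℕ, ∃ u ∈ auxLevel F N',
        SiegelShimuraSet.mk δ (principalLevelSubgroup δ (N' * (k + 1).factorial)) ⟨auxComplexStructure F τ Φ T x, hJ x⟩
            (auxToGspFin F (a, t)) =
          SiegelShimuraSet.mk δ (principalLevelSubgroup δ (N' * (k + 1).factorial)) ⟨auxComplexStructure F τ Φ T x', hJ x'⟩
            (auxToGspFin F (a', t') * auxToGspFin F u) := by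
      intro k
      obtain ⟨P, Q, hP, hQ, hfPQ⟩ := hPQ k
      obtain ⟨s, y, b, rfl⟩ := hsurj (mk k) P
      obtain ⟨s', y', b', rfl⟩ := hsurj (mk k) Q
      rw [hπpt, ← h1] at hP
      rw [hπpt, ← h2] at hQ
      rw [hfeq, hn] at hfPQ
      -- witnesses for `P ↦ PQ.1` and `Q ↦ PQ.2`
      obtain ⟨γ, r₀, l, hγx, hγa, hl, hrl⟩ := hunpack hP.symm
      obtain ⟨γ', r₀', l', hγx', hγa', hl', hrl'⟩ := hunpack hQ.symm
      -- rewrite both Siegel classes through `(x, a, t)` and `(x', a', t')`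
      rw [siegelShimuraSet_mk_eq_mk_mul_of_rel F τ Φ T hT hJ _ γ hγx r₀ hrl,
        siegelShimuraSet_mk_eq_mk_mul_of_rel F τ Φ T hT hJ _ γ' hγx' r₀' hrl'] at hfPQ
      set u : ↥(finAdelic (↥(maximalRealSubfield L)) L (IsCMField.complexConj L) 3 H) × ↥(torusFinAdelic M) :=
        (a⁻¹ * (rationalToFinAdelic (↥(maximalRealSubfield L)) L (IsCMField.complexConj L) 3 H γ * b), l) with hu
      set u' : ↥(finAdelic (↥(maximalRealSubfield L)) L (IsCMField.complexConj L) 3 H) × ↥(torusFinAdelic M) :=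
        (a'⁻¹ * (rationalToFinAdelic (↥(maximalRealSubfield L)) L (IsCMField.complexConj L) 3 H γ' * b'), l') with hu'
      have huK : u ∈ auxLevel F N' := by
        rw [hprod0]; exact Subgroup.mem_prod.2 ⟨hγa, hl⟩
      have hu'K : u' ∈ auxLevel F N' := by
        rw [hprod0]; exact Subgroup.mem_prod.2 ⟨hγa', hl'⟩
      have hκ1 : auxToGspFin F u ∈ principalLevelSubgroup δ 1 :=
        principalLevelSubgroup_anti δ (one_dvd N') ((mem_auxLevel_iff F N' u).1 huK)
      -- move `ũ(u)` across
      rw [siegelShimuraSet_mk_mul_eq_mk_iff _ hκ1] at hfPQ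
      refine ⟨u' * u⁻¹, mul_mem hu'K (inv_mem huK), ?_⟩
      rw [map_mul, map_inv, ← mul_assoc]
      exact hfPQ
    obtain ⟨hmkV, hcl⟩ := shimuraSet_mk_eq_and_classOf_eq_of_forall_siegel_mk_eq F τ Φ T hT hΦ hJ hN'0 (KV 0).1 (LV 0) hprod0 hcore
    exact (summandPointExt_eq_summandPointExt_iff M Sc (LV 0) (KV 0) _ _ x x' a a').2 ⟨hcl, hmkV⟩
  -- §2c Noetherian image-stationarity: ONE level `k₀` with `R_{k₀} ⊆ Δ`
  obtain ⟨k₀, hk₀⟩ := exists_setOf_exists_map_eq_subset_of_iInter_subset (T := Tm) (hproj 0) (S := S) (A := A)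
    (fun k => hproj (mk k)) π f hanti hinter
  -- §3 injectivity at `m₀ = m_{k₀}`
  refine ⟨mk k₀, ?_⟩
  intro x x' a a' t t' hmkeq
  set P := summandPointExt M Sc (LV (mk k₀)) (KV (mk k₀)) (classOf M (LV (mk k₀)) t) x a with hP
  set Q := summandPointExt M Sc (LV (mk k₀)) (KV (mk k₀)) (classOf M (LV (mk k₀)) t') x' a' with hQ
  have hfPQ : AlgPoints.map (f k₀) P = AlgPoints.map (f k₀) Q := (hfeq k₀ t t' x x' a a').2 hmkeq
  have hR : (AlgPoints.map (π k₀) P, AlgPoints.map (π k₀) Q) ∈ {PQ : ComplexPoints Tm × ComplexPoints Tm |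
      ∃ P Q : ComplexPoints (S k₀), AlgPoints.map (π k₀) P = PQ.1 ∧ AlgPoints.map (π k₀) Q = PQ.2 ∧
        AlgPoints.map (f k₀) P = AlgPoints.map (f k₀) Q} := ⟨P, Q, rfl, rfl, hfPQ⟩
  have hD : AlgPoints.map (π k₀) P = AlgPoints.map (π k₀) Q := hk₀ hR
  rw [hP, hQ, hπpt, hπpt] at hD
  obtain ⟨γ, r₀, l, hγx, hγa, hl, hrl⟩ := hunpack hD
  -- `[J_x, ũ(a,t)·κ] = [J_x, ũ(a,t)]` at level `N′(m₀+1)` with `κ = ũ(a⁻¹γa′, l) ∈ K_δ(N′)`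
  set u : ↥(finAdelic (↥(maximalRealSubfield L)) L (IsCMField.complexConj L) 3 H) × ↥(torusFinAdelic M) :=
    (a⁻¹ * (rationalToFinAdelic (↥(maximalRealSubfield L)) L (IsCMField.complexConj L) 3 H γ * a'), l) with hu
  have huK : u ∈ auxLevel F N' := by
    rw [hprod0]; exact Subgroup.mem_prod.2 ⟨hγa, hl⟩
  have hκN' : auxToGspFin F u ∈ principalLevelSubgroup δ N' := (mem_auxLevel_iff F N' u).1 huK
  have hκeq : SiegelShimuraSet.mk δ (principalLevelSubgroup δ (N' * (mk k₀ + 1))) ⟨auxComplexStructure F τ Φ T x, hJ x⟩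
        (auxToGspFin F (a, t) * auxToGspFin F u) =
      SiegelShimuraSet.mk δ (principalLevelSubgroup δ (N' * (mk k₀ + 1))) ⟨auxComplexStructure F τ Φ T x, hJ x⟩
        (auxToGspFin F (a, t)) := by
    rw [← siegelShimuraSet_mk_eq_mk_mul_of_rel F τ Φ T hT hJ _ γ hγx r₀ hrl]
    exact hmkeq.symm
  have hκ : auxToGspFin F u ∈ principalLevelSubgroup δ (N' * (mk k₀ + 1)) :=
    mem_principalLevelSubgroup_of_mk_mul_eq_mk hN' (dvd_mul_right N' _) hκN' _ _ hκeq
  have huKV : u ∈ (KV (mk k₀)).1.1.prod (LV (mk k₀)).1 := by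
    rw [← show auxLevel F (N' * (mk k₀ + 1)) = (KV (mk k₀)).1.1.prod (LV (mk k₀)).1 from hprod (mk k₀)]
    exact (mem_auxLevel_iff F _ u).2 hκ
  obtain ⟨hu1, hu2⟩ := Subgroup.mem_prod.1 huKV
  refine ⟨(ShimuraSet.mk_eq_mk_iff L H τ T hT (KV (mk k₀)).1.1 x x' a a').2 ⟨γ, hγx, hu1⟩, ?_⟩
  rw [classOf, QuotientGroup.mk'_apply, QuotientGroup.mk'_apply, QuotientGroup.eq, hrl]
  exact Subgroup.mul_mem_sup ⟨r₀, rfl⟩ hu2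

/-- Alias in the pen's re-pointing convention (`stub_S2inj := stub_S2inj_holds`): the same theorem, fully qualified type.
HC_CM is proved only modulo the 7 printed citations until rung 0 closes. [cite: Deligne1971TravauxShimura, Prop. 1.15 p. 132] -/
theorem stub_S2inj_holds : Summit.HodgeConjecture.CorCM.HypDel.ExtReceptacle.QArch.S2Inj :=
  stub_S2inj

end Summit.HodgeConjecture.HodgeConjecture.Theorems

end
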